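import Summits.SmoothPoincare4.SmoothPoincare4.Theorems.ConvexBisectionContractibleTwistedDoubleStandardStubSeam
import Summits.SmoothPoincare4.SmoothPoincare4.Theorems.ContractibleTwistedDoubleStandard.Negative.LoadBearing
import Literature.Geometry.Symplectic.SteinFillingSphere
import Literature.Topology.FourManifolds.CerfGammaFour
import Literature.Topology.FourManifolds.CerfGammaFourProofs
import Literature.Topology.FourManifolds.TwistedSpheres
import Literature.Topology.FourManifolds.CorkDecomposition
import Literature.Topology.FourManifolds.ClosedBall
import Literature.Topology.FourManifolds.Handles
import Literature.Topology.FourManifolds.MorseDiscLemma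
import Literature.Topology.FourManifolds.MorseProofs
import Literature.Topology.FourManifolds.HomotopyS4CompactProofs
import Mathlib.Geometry.Manifold.Diffeomorph
import HarnessLib

/-!
# Stub `stub_residualBall` of line `seam-duality-cancellation` for crux `ConvexBisection.AcyclicBisectionRigidity`
(item stmt-SmoothPoincare4-10507, route route-SmoothPoincare4-ConvexBisection)

The **disc-type-half sector** of the crux: an acyclic common-contact Stein bisection
`M = e₁(W₁) ∪ e₂(W₂)` of a homotopy `4`-sphere `M ≃ₕ S⁴` by two compact Stein domains meeting
exactly along both boundary images, with matched complex tangencies, is `S⁴` as soon as the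
first half `W₁` admits a Morse function adapted to `∂W₁` with exactly ONE critical point, of
index `0` (`HasHandleDecomposition 3 W₁ (1,0,0,…)`) — CONDITIONALLY on the two named facts of the
tree which the skeleton files as separate fact-stubs and feeds in as leading hypotheses:

* `Literature.Geometry.Symplectic.Eliashberg1990_steinFilling_sphere_three` (Eliashberg 1990,
  Thm. 5.1: a compact Stein domain bounded by `S³` is `𝔻⁴`);
* `Literature.Topology.FourManifolds.cerf_twistedSphere_four` (Cerf 1968, `Γ₄ = 0`: every twisted
  sphere `𝔻⁴ ∪_φ 𝔻⁴` is `S⁴`).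

Proof.  (1) The adapted Morse function `f` of the handle decomposition has finitely many critical
points (`Literature.Topology.FourManifolds.IsMorse.finite_criticalSet_holds`), so the counts
`ncard = 1` in index `0` and `ncard = 0` elsewhere say that `f` has a unique critical point, of
index `0` (`Literature.Topology.FourManifolds.IsMorseAdapted.exists_unique_isMCriticalPt_of_ncard`);
Milnor's disc theorem (`Literature.Topology.FourManifolds.IsMorseAdapted.nonempty_diffeomorph_closedBall`,
Milnor 1963, Thm. 3.1 with Lemma 2.2) gives `W₁ ≅ 𝔻⁴`.  (2) `M` is compact
(`Literature.Topology.FourManifolds.compactSpace_of_homotopyEquiv_sphere_four_holds`), so the seam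
map `ψ : ∂W₁ ≅ ∂W₂` of the LANDED stub `stub_seam` is available; with the boundary restriction
`∂Φ₁ : ∂W₁ ≅ S³` it shows `∂W₂ ≅ S³`, so `W₂ ≅ 𝔻⁴` by Eliashberg.  (3) `M` is the boundary
gluing `W₁ ∪_ψ W₂` (pieces `e₁`, `e₂`; the seam equations say that `e₁ a = e₂ a'` exactly when
`a = incl₁ z`, `a' = incl₂ (ψ z)`).  (4) Transporting the gluing along `Φ₁⁻¹ : 𝔻⁴ ≅ W₁` and
`Φ₂⁻¹ : 𝔻⁴ ≅ W₂` (`Literature.Topology.FourManifolds.IsBoundaryGluing.transfer`) exhibits `M` as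
a twisted sphere `𝔻⁴ ∪_χ 𝔻⁴`, `χ = ∂Φ₂⁻¹ ≫ ψ⁻¹ ≫ ∂Φ₁ ∈ Diff(S³)`, and Cerf concludes.
Adapted from the landed crux-4 stub `PropertyRMazurHalves.stub_ballHalf`
(`Theorems/ConvexBisectionContractibleTwistedDoubleStandardStubBallHalf.lean`), whose steps
(2)–(4) are repeated verbatim; only the ball hypothesis (handle count instead of "`J₁.φ` Morse
with at most one critical point") and the compactness of `M` (homotopy sphere instead of an
instance) differ.
-/

noncomputable section

-- the prescribed namespace `Summit.<P>.<Sub>.…` duplicates `SmoothPoincare4` (P = Sub)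
set_option linter.dupNamespace false

open scoped Manifold ContDiff Topology ContinuousMap
open Set Function Literature.Topology.FourManifolds Literature.Geometry.Symplectic

namespace Summit.SmoothPoincare4.SmoothPoincare4.Theorems.AcyclicBisectionRigidity.SeamDualityCancellation

/-! ### A compact `4`-manifold with boundary with one `0`-handle and nothing else is a `4`-ball -/

/-- **A compact `4`-manifold with boundary with a handle decomposition into one `0`-handle and
nothing else is diffeomorphic to `𝔻⁴`.**  The adapted Morse function of the decomposition has a
finite critical set (`IsMorse.finite_criticalSet_holds`), so the handle counts `(1,0,0,…)` give a
unique critical point, of index `0` (`IsMorseAdapted.exists_unique_isMCriticalPt_of_ncard`), and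
Milnor's disc theorem (`IsMorseAdapted.nonempty_diffeomorph_closedBall`, Milnor 1963, Thm. 3.1
with Lemma 2.2; Kosinski 1993, VII §2 "attaching no handles") gives the disc.
[cite: Milnor1963, Thm. 3.1 and Lemma 2.2] -/
private theorem nonempty_diffeomorph_closedBall_of_hasHandleDecomposition
    {W : Type*} [TopologicalSpace W] [T2Space W] [ChartedSpace (EuclideanHalfSpace 4) W]
    [IsManifold (𝓡∂ 4) ∞ W] [CompactSpace W]
    (h : HasHandleDecomposition 3 W (fun k => if k = 0 then 1 else 0)) :
    Nonempty (W ≃ₘ⟮𝓡∂ 4, 𝓡∂ 4⟯ Metric.closedBall (0 : EuclideanSpace ℝ (Fin 4)) 1) := by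
  -- adapted from `HasHandleDecomposition.nonempty_diffeomorph_closedBall_of_handleCount_one_zero`
  -- (Literature/Topology/FourManifolds/MorseDiscLemma.lean)
  obtain ⟨f, hf, hcount⟩ := h
  have h0 : (criticalSetOfIndex (𝓡∂ (3 + 1)) f 0).ncard = 1 := by
    rw [hcount 0]
    rfl
  have hne : ∀ i, i ≠ 0 → (criticalSetOfIndex (𝓡∂ (3 + 1)) f i).ncard = 0 := fun i hi => by
    rw [hcount i]
    exact if_neg hi
  obtain ⟨p, hp, hp0, huniq⟩ := hf.exists_unique_isMCriticalPt_of_ncard h0 hne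
  exact hf.nonempty_diffeomorph_closedBall (k := 3) (by norm_num) hp huniq hp0

/-! ### The stub -/

/-- **Stub `stub_residualBall` (disc-type half; conditional on Eliashberg 1990 Thm. 5.1 and Cerf
1968 `Γ₄ = 0`).**  In a common-contact Stein bisection `M = e₁(W₁) ∪ e₂(W₂)` of a homotopy
`4`-sphere by two compact Stein domains meeting exactly along both boundary images with matched
complex tangencies, if `W₁` has a handle decomposition with one `0`-handle and nothing else then
`M ≅ S⁴`: `W₁ ≅ 𝔻⁴` by Milnor's disc theorem
(`nonempty_diffeomorph_closedBall_of_hasHandleDecomposition`); `M` is compact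
(`compactSpace_of_homotopyEquiv_sphere_four_holds`); the seam diffeomorphism `ψ : ∂W₁ ≅ ∂W₂` of
the landed stub `stub_seam` and `∂Φ₁ : ∂W₁ ≅ S³` (`BoundaryData.restrictDiffeomorph`) make
`(W₂, J₂)` a Stein filling of `S³`, hence `W₂ ≅ 𝔻⁴` (hypothesis
`Eliashberg1990_steinFilling_sphere_three`); `M = W₁ ∪_ψ W₂` is a boundary gluing (pieces `e₁`,
`e₂`, seam equations), which transported along `Φ₁⁻¹`, `Φ₂⁻¹` (`IsBoundaryGluing.transfer`) is
a twisted sphere `𝔻⁴ ∪_χ 𝔻⁴`, hence `≅ S⁴` (hypothesis `cerf_twistedSphere_four`).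
Kervaire–Milnor (1963), §1; Cerf (1968); Eliashberg (1990), Thm. 5.1; Milnor (1963), Thm. 3.1.
[folklore] -/
theorem stub_residualBall (hE : Eliashberg1990_steinFilling_sphere_three) (hC : cerf_twistedSphere_four)
    (M : Type) [TopologicalSpace M] [T2Space M] [SecondCountableTopology M]
    [ChartedSpace (EuclideanSpace ℝ (Fin 4)) M]
    [IsManifold (𝓡 4) ∞ M] (hM : M ≃ₕ (Metric.sphere (0 : EuclideanSpace ℝ (Fin 5)) 1))
    (W₁ : Type) [TopologicalSpace W₁] [ChartedSpace (EuclideanHalfSpace 4) W₁] [IsManifold (𝓡∂ 4) ∞ W₁]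
    [CompactSpace W₁] (W₂ : Type) [TopologicalSpace W₂] [ChartedSpace (EuclideanHalfSpace 4) W₂]
    [IsManifold (𝓡∂ 4) ∞ W₂] [CompactSpace W₂] (J₁ : SteinStructure W₁) (J₂ : SteinStructure W₂)
    (e₁ : W₁ → M) (e₂ : W₂ → M)
    (he₁ : Manifold.IsSmoothEmbedding (𝓡∂ 4) (𝓡 4) ∞ e₁)
    (he₂ : Manifold.IsSmoothEmbedding (𝓡∂ 4) (𝓡 4) ∞ e₂)
    (hcover : range e₁ ∪ range e₂ = univ)
    (hseam₁ : range e₁ ∩ range e₂ = e₁ '' (𝓡∂ 4).boundary W₁)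
    (hseam₂ : range e₁ ∩ range e₂ = e₂ '' (𝓡∂ 4).boundary W₂)
    (hξ : ∀ w₁ w₂, e₁ w₁ = e₂ w₂ →
      Submodule.map (mfderiv (𝓡∂ 4) (𝓡 4) e₁ w₁).toLinearMap (contactPlane J₁.J w₁) =
      Submodule.map (mfderiv (𝓡∂ 4) (𝓡 4) e₂ w₂).toLinearMap (contactPlane J₂.J w₂))
    (h₁ : HasHandleDecomposition 3 W₁ (fun k => if k = 0 then 1 else 0)) :
    Nonempty (M ≃ₘ⟮𝓡 4, 𝓡 4⟯ (Metric.sphere (0 : EuclideanSpace ℝ (Fin 5)) 1)) := by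
  -- adapted from `PropertyRMazurHalves.stub_ballHalf`
  -- (Summits/SmoothPoincare4/SmoothPoincare4/Theorems/ConvexBisectionContractibleTwistedDoubleStandardStubBallHalf.lean)
  -- `M` is compact (homotopy `4`-sphere); the halves are Hausdorff and second countable
  haveI : CompactSpace M := compactSpace_of_homotopyEquiv_sphere_four_holds M hM
  haveI : T2Space W₁ := he₁.isEmbedding.t2Space
  haveI : T2Space W₂ := he₂.isEmbedding.t2Space
  haveI : SecondCountableTopology W₁ := he₁.isEmbedding.secondCountableTopology
  haveI : SecondCountableTopology W₂ := he₂.isEmbedding.secondCountableTopology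
  -- (1) the first half is a ball (Milnor's disc theorem)
  obtain ⟨Φ₁⟩ := nonempty_diffeomorph_closedBall_of_hasHandleDecomposition h₁
  -- (2) boundary data, the seam diffeomorphism, and the second half is a ball (Eliashberg)
  obtain ⟨b₁⟩ : Nonempty (BoundaryData (𝓡∂ 4) W₁ (𝓡 3)) := nonempty_boundaryData_holds 3 W₁
  obtain ⟨b₂⟩ : Nonempty (BoundaryData (𝓡∂ 4) W₂ (𝓡 3)) := nonempty_boundaryData_holds 3 W₂
  obtain ⟨ψ, hψ, -⟩ :=
    ContractibleTwistedDoubleStandard.LegendrianRKnotRigidity.stub_seam M W₁ W₂ J₁ J₂ e₁ e₂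
      he₁ he₂ hseam₁ hseam₂ hξ b₁ b₂
  let D : BoundaryData (𝓡∂ 4) (Metric.closedBall (0 : EuclideanSpace ℝ (Fin 4)) 1) (𝓡 3) :=
    closedBallBoundaryData 3
  obtain ⟨Φ₂⟩ := hE.of_steinStructure J₂ b₂ (ψ.symm.trans (b₁.restrictDiffeomorph D Φ₁))
  -- (3) `M = W₁ ∪_ψ W₂`
  have hglue : IsBoundaryGluing b₁ b₂ ψ (𝓡 4) M := by
    refine ⟨e₁, e₂, he₁, he₂, hcover, fun a a' => ⟨fun h => ?_, ?_⟩⟩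
    · obtain ⟨hb, -⟩ :=
        ContractibleTwistedDoubleStandard.Negative.seam_mem_boundary he₁ he₂ hseam₁ hseam₂ h
      have ha : a ∈ range b₁.incl := by rw [b₁.range_incl]; exact hb
      obtain ⟨z, rfl⟩ := ha
      refine ⟨z, rfl, he₂.isEmbedding.injective ?_⟩
      rw [hψ z]
      exact h.symm
    · rintro ⟨z, rfl, rfl⟩
      exact (hψ z).symm
  -- (4) transport to the two balls: `M = 𝔻⁴ ∪_χ 𝔻⁴`, and Cerf
  have hT₁ : IsBoundaryGluing D b₂ (ψ ∘ D.restrictDiffeomorph b₁ Φ₁.symm) (𝓡 4) M :=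
    IsBoundaryGluing.transfer (b₁ := D) Φ₁.symm hglue
  have hT₁' : IsBoundaryGluing D b₂ ⇑((D.restrictDiffeomorph b₁ Φ₁.symm).trans ψ) (𝓡 4) M := hT₁
  have hT₂ : IsBoundaryGluing D D
      (⇑((D.restrictDiffeomorph b₁ Φ₁.symm).trans ψ).symm ∘ D.restrictDiffeomorph b₂ Φ₂.symm)
      (𝓡 4) M :=
    IsBoundaryGluing.transfer (b₁ := D) Φ₂.symm hT₁'.symm'
  let χ : (Metric.sphere (0 : EuclideanSpace ℝ (Fin 4)) 1) ≃ₘ⟮𝓡 3, 𝓡 3⟯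
      (Metric.sphere (0 : EuclideanSpace ℝ (Fin 4)) 1) :=
    (D.restrictDiffeomorph b₂ Φ₂.symm).trans ((D.restrictDiffeomorph b₁ Φ₁.symm).trans ψ).symm
  have hX : IsTwistedSphere 3 χ M := hT₂
  let T : TwistedSphere 3 χ := { carrier := M, isTwistedSphere := hX }
  exact hC χ T

end Summit.SmoothPoincare4.SmoothPoincare4.Theorems.AcyclicBisectionRigidity.SeamDualityCancellation

end
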